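import Literature.Geometry.Riemannian.GurskyViaclovskyClosednessBootstrapAux
import Literature.Geometry.Riemannian.GurskyViaclovskyClosednessEKOperatorDef
import Literature.Geometry.Riemannian.GurskyViaclovskyClosednessHybridMargin
import Literature.Analysis.PDE.EvansKrylovJets
import HarnessLib

/-!
# Gursky–Viaclovsky closedness: quantitative bounds for the Evans–Krylov form of the chart
# equation, I (uniform ellipticity in the Euclidean rank-one form, uniform `C²` bounds)

Support file (everything PROVED; no definition, no named fact) for the named fact
`Literature.Geometry.Riemannian.gurskyViaclovsky_pathClosed_weighted_four`
(Gursky–Viaclovsky, J. Differential Geom. 63 (2003), Prop. 6: the interior `C^{2,α}` estimate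
behind the closedness of the weighted `σ₂` path is Evans–Krylov's, Gilbarg–Trudinger Thm. 17.14).
The concave reformulation of the chart equation is the jet function
`ekOperator G W Q ψ (y, t, J) = ψ(Σ^t(y, pOf J, rOf J)) − ψ(¼(Q(y) e^{4J₀} + ¼W(y)))`,
`Σ^t(y, p, r) = ¼·chartOperator G t 0 y p r = ½((tr_G 𝒜^t)² − |𝒜^t|²_G)`
(`GurskyViaclovskyClosednessEKOperatorDef.lean`), `ψ` a smooth function equal to `√` on
`[c/2, ∞)`. This file and `GurskyViaclovskyClosednessEKBounds.lean` supply the constants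
`(λ, Λ, μ, δ₀)` of the abstract Evans–Krylov theorem for it, uniformly along a sequence of
solutions with uniform chart `C²` bounds, on an open subset `U ⊆ ℝ⁴` carrying a Riemannian
metric `g` with components `G`. Here:

* `ekOperator_symbol_bounds_of_solution` — Gilbarg–Trudinger's structure condition (17.43) for
  the jet function in the Euclidean rank-one form: at the jet of an admissible solution with the
  covariant bounds of the fact, the derivative in the top-slot direction `ξ ⊗ ξ` lies between
  `λ_E/(8√S₁) · ξ·ξ` and `Λ_E/(8√(c/2)) · ξ·ξ`, `λ_E, Λ_E` the constants of
  `symbol_euclid_bounds_along_solution` (chain rule `D(ψ∘Σ) = DΣ/(2√Σ)` along the line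
  `J + ε·single₂(η ⊗ η)`, `c ≤ Σ ≤ S₁` by `le_sigma2Inv_of_equation`);
* `exists_ekOperator_deriv_bounds` — uniform bounds for `D(ekOperator)`, `D²(ekOperator)` and
  `Σ^t` on the compact jet sets `K × [−T, T] × B̄(0, K')`, `K ⊆ U` compact (the jet function is
  `C^∞` on the open set `{x | x.1 ∈ U}`: both arguments of `ψ` are).

The uniform hybrid admissibility margin `δ₀` is in `GurskyViaclovskyClosednessEKBounds.lean`.

## References

* D. Gilbarg, N. S. Trudinger, *Elliptic Partial Differential Equations of Second Order* (2001),
  §17.4, (17.43), Thm. 17.14. [GilbargTrudinger2001]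
* M. J. Gursky, J. A. Viaclovsky, J. Differential Geom. 63 (2003) 131–154, Prop. 6, §5.
  [GurskyViaclovsky2003]
-/

noncomputable section

set_option maxSynthPendingDepth 3

open scoped Manifold ContDiff Topology
open Set Filter Metric Function Module

namespace Literature.Geometry.Riemannian.GurskyViaclovskyPath

open Literature.Geometry.Lorentzian (PseudoRiemannianMetric)
open Literature.Geometry.Lorentzian.PseudoRiemannianMetric
open Literature.Geometry.Lorentzian
open Literature.Geometry.Lorentzian.MetricCoord
open Literature.Geometry.Riemannian.GurskyViaclovsky
open Literature.Analysis.Calculus Literature.Analysis.PDE.EvansKrylov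

section OpensChart

variable {U : TopologicalSpace.Opens (EuclideanSpace ℝ (Fin 4))}
  (g : PseudoRiemannianMetric 𝓘(ℝ, EuclideanSpace ℝ (Fin 4)) ∞ (EuclideanSpace ℝ (Fin 4))
    (TangentSpace 𝓘(ℝ, EuclideanSpace ℝ (Fin 4)) : U → Type _))
  [g.HasLeviCivita]
  {G : EuclideanSpace ℝ (Fin 4) →
    EuclideanSpace ℝ (Fin 4) →L[ℝ] EuclideanSpace ℝ (Fin 4) →L[ℝ] ℝ}
  (hG : ∀ y : U, g.val y = G y)

/-! ### Smoothness of the two arguments of `ψ` -/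

omit [g.HasLeviCivita] in
include hG in
/-- `Σ^t(y, pOf J, rOf J) = ¼·chartOperator G t 0 y (pOf J) (rOf J)` is `C^∞` in `(y, t, J)` on
`{x | x.1 ∈ U}` (`contDiffOn_chartOperator_comp` with `W = 0`; `pOf`, `rOf` are continuous
linear). [folklore] -/
private theorem contDiffOn_sigmaJet :
    ContDiffOn ℝ ∞
      (fun x : EuclideanSpace ℝ (Fin 4) × ℝ × CJet (Fin 4) 2 ↦
        chartOperator G x.2.1 0 x.1 (pOf (EuclideanSpace.basisFun (Fin 4) ℝ) x.2.2)
          (rOf (EuclideanSpace.basisFun (Fin 4) ℝ) x.2.2) / 4)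
      {x | x.1 ∈ (U : Set (EuclideanSpace ℝ (Fin 4)))} := by
  have hmet : IsMetricOn G (U : Set (EuclideanSpace ℝ (Fin 4))) := OpensChart.isMetricOn_repr hG
  have hπ : ContDiffOn ℝ ∞ (fun x : EuclideanSpace ℝ (Fin 4) × ℝ × CJet (Fin 4) 2 ↦ x.1)
      {x | x.1 ∈ (U : Set (EuclideanSpace ℝ (Fin 4)))} :=
    contDiff_fst.contDiffOn
  have hD : MapsTo (fun x : EuclideanSpace ℝ (Fin 4) × ℝ × CJet (Fin 4) 2 ↦ x.1)
      {x | x.1 ∈ (U : Set (EuclideanSpace ℝ (Fin 4)))} U :=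
    fun _ hx ↦ hx
  have hp : ContDiffOn ℝ ∞ (fun x : EuclideanSpace ℝ (Fin 4) × ℝ × CJet (Fin 4) 2 ↦
      pOf (EuclideanSpace.basisFun (Fin 4) ℝ) x.2.2)
      {x | x.1 ∈ (U : Set (EuclideanSpace ℝ (Fin 4)))} :=
    ((isBoundedLinearMap_pOf (EuclideanSpace.basisFun (Fin 4) ℝ)).contDiff.comp
      contDiff_snd.snd).contDiffOn
  have hr : ContDiffOn ℝ ∞ (fun x : EuclideanSpace ℝ (Fin 4) × ℝ × CJet (Fin 4) 2 ↦
      rOf (EuclideanSpace.basisFun (Fin 4) ℝ) x.2.2)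
      {x | x.1 ∈ (U : Set (EuclideanSpace ℝ (Fin 4)))} :=
    ((isBoundedLinearMap_rOf (EuclideanSpace.basisFun (Fin 4) ℝ)).contDiff.comp
      contDiff_snd.snd).contDiffOn
  exact (contDiffOn_chartOperator_comp hmet contDiff_snd.fst.contDiffOn contDiffOn_const hπ hD
    hp hr).div_const 4

omit [g.HasLeviCivita] in
include hG in
/-- The Evans–Krylov jet function is `C^∞` on `{x | x.1 ∈ U}` for `W`, `Q` smooth on `U` and
`ψ` smooth (both arguments of `ψ` are smooth there). [folklore] -/
private theorem ekOperator_smoothOn {W Q : EuclideanSpace ℝ (Fin 4) → ℝ}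
    (hW : ContDiffOn ℝ ∞ W (U : Set (EuclideanSpace ℝ (Fin 4))))
    (hQ : ContDiffOn ℝ ∞ Q (U : Set (EuclideanSpace ℝ (Fin 4)))) {ψ : ℝ → ℝ}
    (hψ : ContDiff ℝ ∞ ψ) :
    ContDiffOn ℝ ∞ (ekOperator G W Q ψ)
      {x : EuclideanSpace ℝ (Fin 4) × ℝ × CJet (Fin 4) 2 |
        x.1 ∈ (U : Set (EuclideanSpace ℝ (Fin 4)))} := by
  have hπ : ContDiffOn ℝ ∞ (fun x : EuclideanSpace ℝ (Fin 4) × ℝ × CJet (Fin 4) 2 ↦ x.1)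
      {x | x.1 ∈ (U : Set (EuclideanSpace ℝ (Fin 4)))} :=
    contDiff_fst.contDiffOn
  have hD : MapsTo (fun x : EuclideanSpace ℝ (Fin 4) × ℝ × CJet (Fin 4) 2 ↦ x.1)
      {x | x.1 ∈ (U : Set (EuclideanSpace ℝ (Fin 4)))} U :=
    fun _ hx ↦ hx
  have h0 : ContDiff ℝ ∞ (fun J : CJet (Fin 4) 2 ↦ J 0 Fin.elim0) :=
    contDiff_pi.1 (contDiff_pi.1 contDiff_id 0) _
  have h2 : ContDiffOn ℝ ∞ (fun x : EuclideanSpace ℝ (Fin 4) × ℝ × CJet (Fin 4) 2 ↦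
      (Q x.1 * Real.exp (4 * x.2.2 0 Fin.elim0) + W x.1 / 4) / 4)
      {x | x.1 ∈ (U : Set (EuclideanSpace ℝ (Fin 4)))} :=
    (((hQ.comp hπ hD).mul (Real.contDiff_exp.comp (contDiff_const.mul
      (h0.comp contDiff_snd.snd))).contDiffOn).add ((hW.comp hπ hD).div_const 4)).div_const 4
  exact (hψ.comp_contDiffOn (contDiffOn_sigmaJet g hG)).sub (hψ.comp_contDiffOn h2)

/-! ### Uniform ellipticity in the Euclidean rank-one form -/

set_option maxHeartbeats 400000 in
include hG in
/-- **Uniform ellipticity of the Evans–Krylov jet function along a solution, Euclidean form**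
(Gilbarg–Trudinger's (17.43) for `F = σ₂^{1/2}(A^t_U) − (…)^{1/2}`): with the hypotheses of
`le_fderiv_jetOperator_single` at the point `y` (equation with `q ≥ q₀ > 0`, admissibility,
`t ≤ 1`, `|t| ≤ T`, covariant bounds, frame of Euclidean length `≤ κ`, `‖G y‖ ≤ Λ_g`), a cutoff
`ψ = √` on `[c/2,∞)`, `0 < c ≤ q₀e^{−4C}/4`, and an upper bound `Σ^t ≤ S₁` at the jet, the
derivative of `ekOperator` at `(y, t, cjet₂F(y))` in the rank-one top-slot direction `ξ ⊗ ξ`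
(`ξ : Fin 4 → ℝ`, realised as the covector `η = Σ ξ_i e_i^*`, `η(e_i) = ξ_i`, `‖η‖² = ξ·ξ`) lies
between `λ_E/(8√S₁) · ξ·ξ` and `Λ_E/(8√(c/2)) · ξ·ξ`, `λ_E, Λ_E` the constants of
`symbol_euclid_bounds_along_solution` (chain rule: `D(ψ∘Σ) = ψ'(Σ) DΣ = DΣ/(2√Σ)`,
`DΣ[η⊗η] = ¼ D_r chartOperator[η⊗η]`, `fderiv_jetOperator_single`, `c/2 ≤ c ≤ Σ ≤ S₁`).
[cite: GilbargTrudinger2001, §17.4, (17.43); GurskyViaclovsky2003, Prop. 6 (proof)] -/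
theorem ekOperator_symbol_bounds_of_solution (hg : g.IsRiemannian)
    {W Q : EuclideanSpace ℝ (Fin 4) → ℝ}
    (hW : ContDiffOn ℝ ∞ W (U : Set (EuclideanSpace ℝ (Fin 4))))
    (hQ : ContDiffOn ℝ ∞ Q (U : Set (EuclideanSpace ℝ (Fin 4)))) {ψ : ℝ → ℝ} {c : ℝ}
    (hψ : ContDiff ℝ ∞ ψ) (hψc : ∀ s, c / 2 ≤ s → ψ s = Real.sqrt s) (hc : 0 < c)
    {f : U → ℝ} (hf : ContMDiff 𝓘(ℝ, EuclideanSpace ℝ (Fin 4)) 𝓘(ℝ) ∞ f)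
    {F : EuclideanSpace ℝ (Fin 4) → ℝ} (hfF : ∀ y : U, f y = F y) {q : U → ℝ}
    {t q₀ C P T S₁ : ℝ} (ht : t ≤ 1) (htT : |t| ≤ T) (hq₀ : 0 < q₀)
    (hcq : c ≤ q₀ * Real.exp (-4 * C) / 4) (hC : 0 ≤ C) (hP : 0 ≤ P) (y : U)
    (hF : ContDiffAt ℝ 2 F y) (hqy : q₀ ≤ q y)
    (heq : backgroundPathOperator g t (fun z ↦ -f z) y = q y * Real.exp (-4 * (-f y)))
    (hpos : 0 < backgroundScalar g (fun z ↦ -f z) y)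
    (hfy : |f y| ≤ C) (hgrad : g.gradSq f y ≤ C) (hhess : g.normSq y (g.hessian f y) ≤ C)
    (hRic : g.normSq y (g.ricci y) ≤ P ^ 2) (hR : |g.scalarCurvature y| ≤ P)
    {b : Basis (Fin 4) ℝ (TangentSpace 𝓘(ℝ, EuclideanSpace ℝ (Fin 4)) y)}
    (hb : g.IsOrthonormalFrame y b) {κ Λg : ℝ} (hκ0 : 0 ≤ κ)
    (hκ : ∀ a, @norm (EuclideanSpace ℝ (Fin 4)) _ (b a) ≤ κ) (hΛg : ‖G y‖ ≤ Λg)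
    (hS₁ : chartOperator G t 0 y (fderiv ℝ F y) (fderiv ℝ (fderiv ℝ F) y) / 4 ≤ S₁)
    (ξ : Fin 4 → ℝ) :
    4 * (q₀ * Real.exp (-4 * C) / 4 /
          (2 * (4 * ((1 + T) * P + (3 + 2 * T) * Real.sqrt C + (5 + 2 * T) * C) + 1))) /
        ((Λg * κ) ^ 2 * 4) / (8 * Real.sqrt S₁) * (ξ ⬝ᵥ ξ) ≤
      fderiv ℝ (ekOperator G W Q ψ)
        ((y : EuclideanSpace ℝ (Fin 4)), t, cjetOf (EuclideanSpace.basisFun (Fin 4) ℝ) 2 F y)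
        ((0 : EuclideanSpace ℝ (Fin 4)), (0 : ℝ), topJet (fun I ↦ ξ (I 0) * ξ (I 1))) ∧
    fderiv ℝ (ekOperator G W Q ψ)
        ((y : EuclideanSpace ℝ (Fin 4)), t, cjetOf (EuclideanSpace.basisFun (Fin 4) ℝ) 2 F y)
        ((0 : EuclideanSpace ℝ (Fin 4)), (0 : ℝ), topJet (fun I ↦ ξ (I 0) * ξ (I 1))) ≤
      4 * (3 * (4 * ((1 + T) * P + (3 + 2 * T) * Real.sqrt C + (5 + 2 * T) * C) + 1) * (2 - t)) *
        (4 * κ ^ 2) / (8 * Real.sqrt (c / 2)) * (ξ ⬝ᵥ ξ) := by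
  -- (a) the covector `η` with `η (e i) = ξ i` and `‖η‖² = ξ ⬝ᵥ ξ`
  set v : EuclideanSpace ℝ (Fin 4) := WithLp.toLp 2 ξ
  set η : EuclideanSpace ℝ (Fin 4) →L[ℝ] ℝ := innerSL ℝ v with hη
  have hηe : ∀ i, η (EuclideanSpace.basisFun (Fin 4) ℝ i) = ξ i := fun i ↦ by
    rw [hη, innerSL_apply_apply, EuclideanSpace.inner_basisFun_real]
  have hnorm : ‖η‖ ^ 2 = ξ ⬝ᵥ ξ := by
    rw [hη, innerSL_apply_norm, EuclideanSpace.real_norm_sq_eq, dotProduct]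
    exact Finset.sum_congr rfl fun i _ ↦ by rw [sq]
  set δJ : CJet (Fin 4) 2 := Pi.single (Fin.last 2) (fun I : Fin 2 → Fin 4 ↦
    η (EuclideanSpace.basisFun (Fin 4) ℝ (I 0)) * η (EuclideanSpace.basisFun (Fin 4) ℝ (I 1)))
    with hδJ
  have htop : topJet (fun I : Fin 2 → Fin 4 ↦ ξ (I 0) * ξ (I 1)) = δJ := by
    rw [hδJ, topJet]
    congr 1
    funext I
    rw [hηe, hηe]
  rw [htop]
  -- (b) the point, the direction, and the value `Σ₀ ≥ c` of the first argument of `ψ`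
  set J₀ : CJet (Fin 4) 2 := cjetOf (EuclideanSpace.basisFun (Fin 4) ℝ) 2 F y
  set x₀ : EuclideanSpace ℝ (Fin 4) × ℝ × CJet (Fin 4) 2 :=
    ((y : EuclideanSpace ℝ (Fin 4)), t, J₀) with hx₀
  set w : EuclideanSpace ℝ (Fin 4) × ℝ × CJet (Fin 4) 2 :=
    ((0 : EuclideanSpace ℝ (Fin 4)), (0 : ℝ), δJ) with hw
  have hpJ : pOf (EuclideanSpace.basisFun (Fin 4) ℝ) J₀ = fderiv ℝ F y := pOf_cjetOf _
  have hrJ : rOf (EuclideanSpace.basisFun (Fin 4) ℝ) J₀ = fderiv ℝ (fderiv ℝ F) y :=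
    rOf_cjetOf _ hF
  set Sig : ℝ := chartOperator G t 0 y (fderiv ℝ F y) (fderiv ℝ (fderiv ℝ F) y) / 4 with hSig
  have hSigc : c ≤ Sig := by
    have h := le_sigma2Inv_of_equation g hG hg t hf hfF hq₀ y hF hqy heq hfy
    have hS : Sig =
        1 / 2 * (mtrAt G y (gvForm G t y (fderiv ℝ F y) (fderiv ℝ (fderiv ℝ F) y)) ^ 2 -
          normSqAt G y (gvForm G t y (fderiv ℝ F y) (fderiv ℝ (fderiv ℝ F) y))) := by
      rw [hSig, chartOperator]
      ring
    rw [hS]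
    exact hcq.trans h
  have hSig0 : 0 < Sig := hc.trans_le hSigc
  -- the symbol of the chart operator in the direction `η ⊗ η` and its two-sided bounds
  obtain ⟨k1, k2⟩ := symbol_euclid_bounds_along_solution g hG hg hf hfF ht htT hq₀ hC hP y hF hqy
    heq hpos hfy hgrad hhess hRic hR hb hκ0 hκ hΛg 0 η
  set Dr : ℝ := fderiv ℝ (fun r ↦ chartOperator G t 0 y (fderiv ℝ F y) r)
    (fderiv ℝ (fderiv ℝ F) y) (η.smulRight η)
  -- (c) the chain rule along the line `J₀ + ε δJ`
  have hkey : fderiv ℝ (ekOperator G W Q ψ) x₀ w = 1 / (2 * Real.sqrt Sig) * (Dr / 4) := by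
    have hopen : IsOpen {x : EuclideanSpace ℝ (Fin 4) × ℝ × CJet (Fin 4) 2 |
        x.1 ∈ (U : Set (EuclideanSpace ℝ (Fin 4)))} :=
      U.2.preimage continuous_fst
    have hdE : DifferentiableAt ℝ (ekOperator G W Q ψ) x₀ :=
      ((ekOperator_smoothOn g hG hW hQ hψ).differentiableOn (by simp)).differentiableAt
        (hopen.mem_nhds y.2)
    have hlp := (isBoundedLinearMap_pOf (EuclideanSpace.basisFun (Fin 4) ℝ)).toIsLinearMap
    have hlr := (isBoundedLinearMap_rOf (EuclideanSpace.basisFun (Fin 4) ℝ)).toIsLinearMap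
    have hline : ∀ ε : ℝ, ekOperator G W Q ψ (x₀ + ε • w) =
        ψ (chartOperator G t 0 y (fderiv ℝ F y)
            (fderiv ℝ (fderiv ℝ F) y + ε • η.smulRight η) / 4) -
          ψ ((Q y * Real.exp (4 * J₀ 0 Fin.elim0) + W y / 4) / 4) := by
      intro ε
      have h1 : x₀ + ε • w = ((y : EuclideanSpace ℝ (Fin 4)), t, J₀ + ε • δJ) := by
        simp only [hx₀, hw, Prod.smul_mk, smul_zero, Prod.mk_add_mk, add_zero]
      have hp : pOf (EuclideanSpace.basisFun (Fin 4) ℝ) (J₀ + ε • δJ) = fderiv ℝ F y := by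
        rw [hlp.map_add, hlp.map_smul, hδJ, pOf_single_last, smul_zero, add_zero, hpJ]
      have hr : rOf (EuclideanSpace.basisFun (Fin 4) ℝ) (J₀ + ε • δJ) =
          fderiv ℝ (fderiv ℝ F) y + ε • η.smulRight η := by
        rw [hlr.map_add, hlr.map_smul, hδJ, rOf_single_sq, hrJ]
      have h0 : (J₀ + ε • δJ) 0 Fin.elim0 = J₀ 0 Fin.elim0 := by
        have hz : δJ 0 = 0 := by rw [hδJ]; exact Pi.single_eq_of_ne (by decide) _
        have hz' : (ε • δJ) 0 Fin.elim0 = 0 := by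
          rw [Pi.smul_apply, hz, smul_zero]
          rfl
        rw [Pi.add_apply, Pi.add_apply, hz', add_zero]
      rw [h1, ekOperator_apply, hp, hr, h0]
    have hℓ : HasDerivAt (fun ε : ℝ ↦ x₀ + ε • w) w 0 := by
      simpa using ((hasDerivAt_id (0 : ℝ)).smul_const w).const_add x₀
    have hd1 : HasDerivAt (fun ε : ℝ ↦ ekOperator G W Q ψ (x₀ + ε • w))
        (fderiv ℝ (ekOperator G W Q ψ) x₀ w) 0 :=
      hdE.hasFDerivAt.comp_hasDerivAt_of_eq (0 : ℝ) hℓ (by simp)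
    -- the same function, differentiated through `ψ ∘ (r ↦ Σ)` along `r₀ + ε η ⊗ η`
    have hdch : DifferentiableAt ℝ (fun r ↦ chartOperator G t 0 y (fderiv ℝ F y) r)
        (fderiv ℝ (fderiv ℝ F) y) :=
      ((contDiff_chartOperator_right g hG t 0 y (fderiv ℝ F y)).differentiable
        (by simp)).differentiableAt
    have hℓ' : HasDerivAt (fun ε : ℝ ↦ fderiv ℝ (fderiv ℝ F) y + ε • η.smulRight η)
        (η.smulRight η) 0 := by
      simpa using ((hasDerivAt_id (0 : ℝ)).smul_const (η.smulRight η)).const_add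
        (fderiv ℝ (fderiv ℝ F) y)
    have hd2a : HasDerivAt (fun ε : ℝ ↦ chartOperator G t 0 y (fderiv ℝ F y)
        (fderiv ℝ (fderiv ℝ F) y + ε • η.smulRight η) / 4) (Dr / 4) 0 :=
      (hdch.hasFDerivAt.comp_hasDerivAt_of_eq (0 : ℝ) hℓ' (by simp)).div_const 4
    have hψd : HasDerivAt ψ (1 / (2 * Real.sqrt Sig)) Sig := by
      refine (Real.hasDerivAt_sqrt hSig0.ne').congr_of_eventuallyEq ?_
      filter_upwards [Ioi_mem_nhds (show c / 2 < Sig by linarith)] with s hs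
      exact hψc s (le_of_lt hs)
    have hd2 : HasDerivAt (fun ε : ℝ ↦ ψ (chartOperator G t 0 y (fderiv ℝ F y)
          (fderiv ℝ (fderiv ℝ F) y + ε • η.smulRight η) / 4) -
        ψ ((Q y * Real.exp (4 * J₀ 0 Fin.elim0) + W y / 4) / 4))
        (1 / (2 * Real.sqrt Sig) * (Dr / 4)) 0 :=
      (hψd.comp_of_eq (0 : ℝ) hd2a (by simp [hSig])).sub_const _
    rw [funext hline] at hd1
    exact hd1.unique hd2
  -- (d) the bounds
  have hT : 0 ≤ T := (abs_nonneg t).trans htT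
  set K := (1 + T) * P + (3 + 2 * T) * Real.sqrt C + (5 + 2 * T) * C with hK_def
  have hK0 : 0 ≤ K := by rw [hK_def]; positivity
  set lam := 4 * (q₀ * Real.exp (-4 * C) / 4 / (2 * (4 * K + 1))) / ((Λg * κ) ^ 2 * 4)
    with hlam_def
  have hlam0 : 0 ≤ lam := by rw [hlam_def]; positivity
  set Lam := 4 * (3 * (4 * K + 1) * (2 - t)) * (4 * κ ^ 2) with hLam_def
  have hLam0 : 0 ≤ Lam := by
    rw [hLam_def]
    have h2t : 0 ≤ 2 - t := by linarith
    positivity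
  have hη0 : 0 ≤ ‖η‖ ^ 2 := sq_nonneg _
  have hsq0 : 0 < Real.sqrt Sig := Real.sqrt_pos.2 hSig0
  have hsqS : Real.sqrt Sig ≤ Real.sqrt S₁ := Real.sqrt_le_sqrt hS₁
  have hsqc0 : 0 < Real.sqrt (c / 2) := Real.sqrt_pos.2 (by linarith)
  have hsqc : Real.sqrt (c / 2) ≤ Real.sqrt Sig := Real.sqrt_le_sqrt (by linarith)
  have k1' : lam * ‖η‖ ^ 2 ≤ Dr := k1
  have k2' : Dr ≤ Lam * ‖η‖ ^ 2 := k2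
  rw [hkey, ← hnorm]
  constructor
  · calc lam / (8 * Real.sqrt S₁) * ‖η‖ ^ 2 = lam * ‖η‖ ^ 2 / (8 * Real.sqrt S₁) := by ring
      _ ≤ lam * ‖η‖ ^ 2 / (8 * Real.sqrt Sig) :=
          div_le_div_of_nonneg_left (mul_nonneg hlam0 hη0) (by positivity) (by linarith)
      _ ≤ Dr / (8 * Real.sqrt Sig) := div_le_div_of_nonneg_right k1' (by positivity)
      _ = 1 / (2 * Real.sqrt Sig) * (Dr / 4) := by ring
  · calc 1 / (2 * Real.sqrt Sig) * (Dr / 4) = Dr / (8 * Real.sqrt Sig) := by ring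
      _ ≤ Lam * ‖η‖ ^ 2 / (8 * Real.sqrt Sig) := div_le_div_of_nonneg_right k2' (by positivity)
      _ ≤ Lam * ‖η‖ ^ 2 / (8 * Real.sqrt (c / 2)) :=
          div_le_div_of_nonneg_left (mul_nonneg hLam0 hη0) (by positivity) (by linarith)
      _ = Lam / (8 * Real.sqrt (c / 2)) * ‖η‖ ^ 2 := by ring

/-! ### Uniform `C²` bounds of the jet function on compact jet sets -/

omit [g.HasLeviCivita] in
include hG in
/-- **Uniform bounds for the Evans–Krylov jet function and its first two derivatives on compact
jet sets**: for `W`, `Q` smooth on `U`, `ψ` smooth, a compact `K ⊆ U`, and bounds `T`, `K'`,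
there is `μ` with `‖D(ekOperator)(z,t,J)‖, ‖D²(ekOperator)(z,t,J)‖, |Σ^t(z, pOf J, rOf J)| ≤ μ`
for all `z ∈ K`, `|t| ≤ T`, `‖J‖ ≤ K'` (continuity of the derivatives of a `C^∞` function on
the open set `{x | x.1 ∈ U}`, compactness of `K × [−T,T] × B̄(0,K')`). This gives the constants
`μ` of Gilbarg–Trudinger's Thm. 17.14 ("C depends on the first and second derivatives of F")
uniformly along a sequence of solutions with uniform chart `C²` bounds.
[cite: GilbargTrudinger2001, §17.4, Thm. 17.14] -/
theorem exists_ekOperator_deriv_bounds {W Q : EuclideanSpace ℝ (Fin 4) → ℝ}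
    (hW : ContDiffOn ℝ ∞ W (U : Set (EuclideanSpace ℝ (Fin 4))))
    (hQ : ContDiffOn ℝ ∞ Q (U : Set (EuclideanSpace ℝ (Fin 4)))) {ψ : ℝ → ℝ}
    (hψ : ContDiff ℝ ∞ ψ) {K : Set (EuclideanSpace ℝ (Fin 4))} (hK : IsCompact K)
    (hKU : K ⊆ (U : Set (EuclideanSpace ℝ (Fin 4)))) (T K' : ℝ) :
    ∃ μ : ℝ, 0 ≤ μ ∧ ∀ t : ℝ, |t| ≤ T → ∀ z ∈ K, ∀ J : CJet (Fin 4) 2, ‖J‖ ≤ K' →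
      ‖fderiv ℝ (ekOperator G W Q ψ) (z, t, J)‖ ≤ μ ∧
      ‖fderiv ℝ (fderiv ℝ (ekOperator G W Q ψ)) (z, t, J)‖ ≤ μ ∧
      |chartOperator G t 0 z (pOf (EuclideanSpace.basisFun (Fin 4) ℝ) J)
          (rOf (EuclideanSpace.basisFun (Fin 4) ℝ) J) / 4| ≤ μ := by
  set O : Set (EuclideanSpace ℝ (Fin 4) × ℝ × CJet (Fin 4) 2) :=
    {x | x.1 ∈ (U : Set (EuclideanSpace ℝ (Fin 4)))}
  have hO : IsOpen O := U.2.preimage continuous_fst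
  have hsm : ContDiffOn ℝ ∞ (ekOperator G W Q ψ) O := ekOperator_smoothOn g hG hW hQ hψ
  set Kc : Set (EuclideanSpace ℝ (Fin 4) × ℝ × CJet (Fin 4) 2) :=
    K ×ˢ (Icc (-T) T ×ˢ closedBall (0 : CJet (Fin 4) 2) K')
  have hKc : IsCompact Kc := hK.prod (isCompact_Icc.prod (isCompact_closedBall _ _))
  have hKcO : Kc ⊆ O := fun x hx ↦ hKU hx.1
  have hc1 : ContinuousOn (fderiv ℝ (ekOperator G W Q ψ)) O :=
    hsm.continuousOn_fderiv_of_isOpen hO (by simp)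
  have hsm' : ContDiffOn ℝ ∞ (fderiv ℝ (ekOperator G W Q ψ)) O :=
    hsm.fderiv_of_isOpen hO (by simp)
  have hc2 : ContinuousOn (fderiv ℝ (fderiv ℝ (ekOperator G W Q ψ))) O :=
    hsm'.continuousOn_fderiv_of_isOpen hO (by simp)
  obtain ⟨C₁, hC₁⟩ := hKc.exists_bound_of_continuousOn (hc1.mono hKcO)
  obtain ⟨C₂, hC₂⟩ := hKc.exists_bound_of_continuousOn (hc2.mono hKcO)
  obtain ⟨C₃, hC₃⟩ :=
    hKc.exists_bound_of_continuousOn ((contDiffOn_sigmaJet g hG).continuousOn.mono hKcO)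
  refine ⟨max (max C₁ C₂) (max C₃ 0), le_max_of_le_right (le_max_right _ _),
    fun t ht z hz J hJ ↦ ?_⟩
  have hx : ((z, t, J) : EuclideanSpace ℝ (Fin 4) × ℝ × CJet (Fin 4) 2) ∈ Kc :=
    ⟨hz, abs_le.1 ht, mem_closedBall_zero_iff.2 hJ⟩
  refine ⟨(hC₁ _ hx).trans ((le_max_left _ _).trans (le_max_left _ _)),
    (hC₂ _ hx).trans ((le_max_right _ _).trans (le_max_left _ _)), ?_⟩
  have h3 := hC₃ _ hx
  rw [Real.norm_eq_abs] at h3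
  exact h3.trans ((le_max_left _ _).trans (le_max_right _ _))

end OpensChart

end Literature.Geometry.Riemannian.GurskyViaclovskyPath

end
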